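import Summits.QuantumFields.YangMills.Theorems.FemtoCutoffLadderThinning
import HarnessLib

/-!
# Route `FlatTubeReduction`, crux `PinnedUnitStepEx` (stmt-QuantumFields-27561), stub `stub_smearVarPosGS1` — D3: cyclic windows in the thinning frame

Seat ym-line-fcl-p3 g9 (2026-08-28).  Blueprint file D3 (the «cyclic words» combinatorics), written directly in the frame of the tree's thinning
embedding `ι = thinCoord (L'+1) L' : ℤ/L' → ℤ/(L'+1)` (`ι 0 = 0`, `ι a = a + 1` for `a ≠ 0`; the fine coordinate `1` is skipped).  A decoder
component `u ∈ ℤ/(L'+1)` reads the coarse coordinate `a` at the fine coordinate `ι a − u` and DELETES the fine coordinate `1 − u`.  For a set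
`D ⊆ ℤ/(L'+1)` of «good» fine coordinates (in the application: the contractible slices of a fine support), its coarse pull-back is
`W_u(D) = {a | ι a − u ∈ D}`.  We compare WINDOWS (cyclic intervals `c, c+1, …, c+t`):
* `thinCoord_add_nat_of_ne_zero` — `ι(a + i) = ι a + i` as long as the coarse window `a, …, a+i−1` avoids `0` (no doubled step);
* `coarse_window_of_fine_window` (M1) — a fine window of `D` of length `t+1` AVOIDING the deleted coordinate pulls back to a coarse window of
  `W_u(D)` of length `t+1`;
* `fine_window_of_coarse_window` (M2) — a coarse window of `W_u(D)` of length `t+1` pushes forward to a fine window of `D` of length `t+1`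
  avoiding the deleted coordinate, or of length `t+2` through it.
Consequence used in D5: if the longest fine window of `D` has length `ℓ+1` and is the ONLY window of that length, then `W_u(D)` has a window of
length `ℓ+1` iff the deleted coordinate `1 − u` lies outside it (`exists_coarse_window_iff_not_mem`).  Pure `ZMod` arithmetic; no measure theory.
R2b1 RECORD rung; nothing here is a summit, a crux or the stub.
-/

set_option autoImplicit false

namespace Summit.QuantumFields.YangMills.Theorems.FlatTubeReduction.Decimation

open Summit.QuantumFields.YangMills.Theorems.FemtoCutoffLadder.Thinning

variable {L' : ℕ} [NeZero L']

omit [NeZero L'] in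
/-- At `L = L'+1` a coarse step is doubled exactly at the coordinate `0`. [folklore] -/
theorem thinSteps_succ_eq (a : ZMod L') : thinSteps (L' + 1) L' a = if a = 0 then 2 else 1 := by
  unfold thinSteps
  have h : (a.val < L' + 1 - L') ↔ a = 0 := by rw [Nat.add_sub_cancel_left, Nat.lt_one_iff, ZMod.val_eq_zero]
  by_cases ha : a = 0
  · rw [if_pos (h.2 ha), if_pos ha]
  · rw [if_neg (mt h.1 ha), if_neg ha]

/-- One step of the frame: `ι(a+1) = ι a + 1` off `0`, `ι(0+1) = ι 0 + 2`. [folklore] -/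
theorem thinCoord_succ_add_one (a : ZMod L') :
    thinCoord (L' + 1) L' (a + 1) = thinCoord (L' + 1) L' a + (if a = 0 then 2 else 1) := by
  rw [thinCoord_add_one (Nat.le_succ L') (by have := NeZero.one_le (n := L'); omega) a, thinSteps_succ_eq]
  split_ifs <;> simp

/-- **Windows without a doubled step**: if `a, a+1, …, a+(i−1)` are all non-zero then `ι(a+i) = ι a + i`. [folklore] -/
theorem thinCoord_add_nat_of_ne_zero (a : ZMod L') (i : ℕ) (h : ∀ i' : ℕ, i' < i → a + (i' : ZMod L') ≠ 0) :
    thinCoord (L' + 1) L' (a + (i : ZMod L')) = thinCoord (L' + 1) L' a + (i : ZMod (L' + 1)) := by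
  induction i with
  | zero => simp
  | succ i ih =>
    have ih' := ih fun i' hi' => h i' (Nat.lt_succ_of_lt hi')
    have hne : a + (i : ZMod L') ≠ 0 := h i (Nat.lt_succ_self i)
    rw [Nat.cast_succ, ← add_assoc, thinCoord_succ_add_one, if_neg hne, ih', Nat.cast_succ, add_assoc]

/-- **Windows through the doubled step**: if `a + i₀ = 0` for some `i₀ < i` (and the window `a, …, a+i` has length `≤ L'`, so this happens once)
then `ι(a+i) = ι a + i + 1`. [folklore] -/
theorem thinCoord_add_nat_of_eq_zero (a : ZMod L') {i i₀ : ℕ} (hi₀ : i₀ < i) (hi : i ≤ L') (h0 : a + (i₀ : ZMod L') = 0) :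
    thinCoord (L' + 1) L' (a + (i : ZMod L')) = thinCoord (L' + 1) L' a + (i : ZMod (L' + 1)) + 1 := by
  -- before `i₀` no zero, at `i₀` the doubled step, after `i₀` no zero again (a window of length ≤ L' meets 0 at most once)
  have hbefore : ∀ i' : ℕ, i' < i₀ → a + (i' : ZMod L') ≠ 0 := by
    intro i' hi' h'
    have : ((i₀ : ℕ) : ZMod L') = (i' : ℕ) := by
      have e1 : (i₀ : ZMod L') = -a := eq_neg_of_add_eq_zero_right h0
      have e2 : (i' : ZMod L') = -a := eq_neg_of_add_eq_zero_right h'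
      rw [e1, e2]
    have hval := congrArg ZMod.val this
    rw [ZMod.val_natCast, ZMod.val_natCast, Nat.mod_eq_of_lt (by omega), Nat.mod_eq_of_lt (by omega)] at hval
    omega
  have h1 : thinCoord (L' + 1) L' (a + (i₀ : ZMod L')) = thinCoord (L' + 1) L' a + (i₀ : ZMod (L' + 1)) :=
    thinCoord_add_nat_of_ne_zero a i₀ hbefore
  -- the step at `i₀`
  have h2 : thinCoord (L' + 1) L' (a + ((i₀ + 1 : ℕ) : ZMod L')) = thinCoord (L' + 1) L' a + ((i₀ + 1 : ℕ) : ZMod (L' + 1)) + 1 := by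
    rw [Nat.cast_succ, ← add_assoc, thinCoord_succ_add_one, if_pos h0, h1]
    push_cast; ring
  -- after `i₀`: no further zero
  have hafter : ∀ i' : ℕ, i' < i - (i₀ + 1) → (a + ((i₀ + 1 : ℕ) : ZMod L')) + (i' : ZMod L') ≠ 0 := by
    intro i' hi' h'
    have e : a + (((i₀ + 1 + i' : ℕ)) : ZMod L') = 0 := by push_cast at h' ⊢; rw [← h']; ring
    have : (((i₀ + 1 + i' : ℕ)) : ZMod L') = ((i₀ : ℕ) : ZMod L') := by
      rw [eq_neg_of_add_eq_zero_right e, eq_neg_of_add_eq_zero_right h0]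
    have hval := congrArg ZMod.val this
    rw [ZMod.val_natCast, ZMod.val_natCast, Nat.mod_eq_of_lt (by omega), Nat.mod_eq_of_lt (by omega)] at hval
    omega
  have h3 := thinCoord_add_nat_of_ne_zero (a + ((i₀ + 1 : ℕ) : ZMod L')) (i - (i₀ + 1)) hafter
  have hsplit : (a + ((i₀ + 1 : ℕ) : ZMod L')) + ((i - (i₀ + 1) : ℕ) : ZMod L') = a + (i : ZMod L') := by
    rw [add_assoc, ← Nat.cast_add, Nat.add_sub_cancel' hi₀]
  rw [hsplit] at h3
  rw [h3, h2]
  have : ((i₀ + 1 : ℕ) : ZMod (L' + 1)) + ((i - (i₀ + 1) : ℕ) : ZMod (L' + 1)) = (i : ZMod (L' + 1)) := by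
    rw [← Nat.cast_add, Nat.add_sub_cancel' hi₀]
  rw [← this]
  ring

/-- The skipped fine coordinate: `ι a ≠ 1` for every `a` (at `L = L'+1`). [folklore] -/
theorem thinCoord_ne_one (a : ZMod L') : thinCoord (L' + 1) L' a ≠ 1 := by
  have h := thinCoord_add_one_not_mem_range (L := L' + 1) (Nat.le_succ L') (a := 0) (by rw [ZMod.val_zero]; omega) a
  rwa [(thinCoord_eq_zero_iff (Nat.le_succ L') 0).2 rfl, zero_add] at h

/-- Every fine coordinate other than `1` is some `ι a`. [folklore] -/
theorem exists_thinCoord_eq {c : ZMod (L' + 1)} (hc : c ≠ 1) : ∃ a : ZMod L', thinCoord (L' + 1) L' a = c := by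
  -- `ι` is injective from a set of size `L'` into the `L'` fine coordinates `≠ 1`
  classical
  have hinj := thinCoord_injective (L := L' + 1) (L' := L') (Nat.le_succ L')
  have himg : (Finset.univ.image (thinCoord (L' + 1) L')) = Finset.univ.erase (1 : ZMod (L' + 1)) := by
    apply Finset.eq_of_subset_of_card_le
    · intro x hx
      obtain ⟨a, -, rfl⟩ := Finset.mem_image.1 hx
      exact Finset.mem_erase.2 ⟨thinCoord_ne_one a, Finset.mem_univ _⟩
    · rw [Finset.card_erase_of_mem (Finset.mem_univ _), Finset.card_univ, ZMod.card,
        Finset.card_image_of_injective _ hinj, Finset.card_univ, ZMod.card]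
      omega
  have : c ∈ Finset.univ.image (thinCoord (L' + 1) L') := by
    rw [himg]; exact Finset.mem_erase.2 ⟨hc, Finset.mem_univ _⟩
  obtain ⟨a, -, ha⟩ := Finset.mem_image.1 this
  exact ⟨a, ha⟩

/-- **(M1) A fine window avoiding the deleted coordinate pulls back to a coarse window of the same length.**  If none of `c, c+1, …, c+t` is
the deleted coordinate `1 − u`, then for the coarse `a` with `ι a − u = c` one has `ι(a+i) − u = c + i` for all `i ≤ t` (so a fine window of `D`
avoiding `1 − u` is the image of a coarse window of `W_u(D) = {b | ι b − u ∈ D}` of the same length). [folklore] -/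
theorem coarse_window_of_fine_window (u : ZMod (L' + 1)) {c : ZMod (L' + 1)} {t : ℕ}
    (hd : ∀ i : ℕ, i ≤ t → c + (i : ZMod (L' + 1)) ≠ 1 - u) :
    ∃ a : ZMod L', thinCoord (L' + 1) L' a - u = c ∧
      ∀ i : ℕ, i ≤ t → thinCoord (L' + 1) L' (a + (i : ZMod L')) - u = c + (i : ZMod (L' + 1)) := by
  have hc1 : c + u ≠ 1 := by
    intro h; exact hd 0 (Nat.zero_le _) (by rw [Nat.cast_zero, add_zero, ← h, add_sub_cancel_right])
  obtain ⟨a, ha⟩ := exists_thinCoord_eq hc1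
  refine ⟨a, by rw [ha, add_sub_cancel_right], ?_⟩
  -- by induction: no step of the coarse window is doubled, since a doubled step would land on `1 − u + … `
  intro i hi
  induction i with
  | zero => simp [ha]
  | succ i ih =>
    have ih' := ih (Nat.le_of_succ_le hi)
    have hne : a + (i : ZMod L') ≠ 0 := by
      intro h0
      -- then `ι(a+i+1) = ι(a+i) + 2`, so the fine coordinate `ι(a+i) − u + 1 = c + i + 1` equals the deleted one `1 − u`
      have : thinCoord (L' + 1) L' (a + (i : ZMod L')) = 0 := by rw [h0]; exact (thinCoord_eq_zero_iff (Nat.le_succ L') 0).2 rfl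
      have hci : c + ((i : ℕ) : ZMod (L' + 1)) = 0 - u := by rw [← ih', this]
      exact hd (i + 1) hi (by rw [Nat.cast_succ, ← add_assoc, hci]; ring)
    rw [Nat.cast_succ, ← add_assoc, thinCoord_succ_add_one, if_neg hne, Nat.cast_succ, ← add_assoc, ← ih']
    ring

/-- **(M2) A coarse window pushes forward to a fine window, possibly one longer.**  If `a, …, a+t` (`t < L'`) all lie in `W_u(D)`, then either
`ι a − u, …, ι a − u + t ∈ D` and none of these is `1 − u` (no doubled step), or `ι a − u, …, ι a − u + (t+1) ∈ D` and the deleted coordinate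
`1 − u` is among them (one doubled step). [folklore] -/
theorem fine_window_of_coarse_window (u : ZMod (L' + 1)) {D : Finset (ZMod (L' + 1))} (hdel : 1 - u ∈ D) {a : ZMod L'} {t : ℕ}
    (ht : t < L') (hW : ∀ i : ℕ, i ≤ t → thinCoord (L' + 1) L' (a + (i : ZMod L')) - u ∈ D) :
    (∀ i : ℕ, i ≤ t → thinCoord (L' + 1) L' a - u + (i : ZMod (L' + 1)) ∈ D ∧
        thinCoord (L' + 1) L' a - u + (i : ZMod (L' + 1)) ≠ 1 - u) ∨
      ((∀ i : ℕ, i ≤ t + 1 → thinCoord (L' + 1) L' a - u + (i : ZMod (L' + 1)) ∈ D) ∧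
        ∃ i : ℕ, i ≤ t + 1 ∧ thinCoord (L' + 1) L' a - u + (i : ZMod (L' + 1)) = 1 - u) := by
  by_cases hz : ∃ i₀ : ℕ, i₀ < t ∧ a + (i₀ : ZMod L') = 0
  · obtain ⟨i₀, hi₀, h0⟩ := hz
    right
    have key : ∀ i : ℕ, i ≤ t + 1 → thinCoord (L' + 1) L' a - u + (i : ZMod (L' + 1)) ∈ D := by
      intro i hi
      by_cases hle : i ≤ i₀
      · -- before the doubled step: `= ι(a+i) − u`
        have hne : ∀ i' : ℕ, i' < i → a + (i' : ZMod L') ≠ 0 := by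
          intro i' hi' h'
          have e : ((i₀ : ℕ) : ZMod L') = (i' : ℕ) := by
            rw [eq_neg_of_add_eq_zero_right h0, eq_neg_of_add_eq_zero_right h']
          have hval := congrArg ZMod.val e
          rw [ZMod.val_natCast, ZMod.val_natCast, Nat.mod_eq_of_lt (by omega), Nat.mod_eq_of_lt (by omega)] at hval
          omega
        have := hW i (by omega)
        rwa [thinCoord_add_nat_of_ne_zero a i hne, add_sub_right_comm] at this
      · push Not at hle
        by_cases hi1 : i = i₀ + 1
        · -- the deleted coordinate itself: `ι(a+i₀) − u + 1 = 0 − u + 1 = 1 − u`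
          subst hi1
          have h1 := thinCoord_add_nat_of_ne_zero a i₀ (fun i' hi' h' => by
            have e : ((i₀ : ℕ) : ZMod L') = (i' : ℕ) := by
              rw [eq_neg_of_add_eq_zero_right h0, eq_neg_of_add_eq_zero_right h']
            have hval := congrArg ZMod.val e
            rw [ZMod.val_natCast, ZMod.val_natCast, Nat.mod_eq_of_lt (by omega), Nat.mod_eq_of_lt (by omega)] at hval
            omega)
          have hz0 : thinCoord (L' + 1) L' (a + (i₀ : ZMod L')) = 0 := by
            rw [h0]; exact (thinCoord_eq_zero_iff (Nat.le_succ L') 0).2 rfl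
          have : thinCoord (L' + 1) L' a - u + ((i₀ + 1 : ℕ) : ZMod (L' + 1)) = 1 - u := by
            rw [hz0] at h1
            have e : thinCoord (L' + 1) L' a = -(i₀ : ZMod (L' + 1)) := eq_neg_of_add_eq_zero_left h1.symm
            rw [e]; push_cast; ring
          rw [this]; exact hdel
        · -- after the doubled step: `= ι(a + (i−1)) − u`
          have hi2 : i₀ + 1 < i := by omega
          have := hW (i - 1) (by omega)
          rw [thinCoord_add_nat_of_eq_zero a (i₀ := i₀) (by omega) (by omega) h0] at this
          have e : thinCoord (L' + 1) L' a + ((i - 1 : ℕ) : ZMod (L' + 1)) + 1 - u =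
              thinCoord (L' + 1) L' a - u + (i : ZMod (L' + 1)) := by
            have : ((i - 1 : ℕ) : ZMod (L' + 1)) + 1 = (i : ZMod (L' + 1)) := by
              rw [← Nat.cast_succ]; congr 1; omega
            rw [← this]; ring
          rwa [e] at this
    refine ⟨key, i₀ + 1, by omega, ?_⟩
    have h1 := thinCoord_add_nat_of_ne_zero a i₀ (fun i' hi' h' => by
      have e : ((i₀ : ℕ) : ZMod L') = (i' : ℕ) := by
        rw [eq_neg_of_add_eq_zero_right h0, eq_neg_of_add_eq_zero_right h']
      have hval := congrArg ZMod.val e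
      rw [ZMod.val_natCast, ZMod.val_natCast, Nat.mod_eq_of_lt (by omega), Nat.mod_eq_of_lt (by omega)] at hval
      omega)
    have hz0 : thinCoord (L' + 1) L' (a + (i₀ : ZMod L')) = 0 := by
      rw [h0]; exact (thinCoord_eq_zero_iff (Nat.le_succ L') 0).2 rfl
    rw [hz0] at h1
    have e : thinCoord (L' + 1) L' a = -(i₀ : ZMod (L' + 1)) := eq_neg_of_add_eq_zero_left h1.symm
    rw [e]; push_cast; ring
  · push Not at hz
    left
    intro i hi
    have hne : ∀ i' : ℕ, i' < i → a + (i' : ZMod L') ≠ 0 := fun i' hi' => hz i' (by omega)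
    have h1 := thinCoord_add_nat_of_ne_zero a i hne
    have := hW i hi
    rw [h1, add_sub_right_comm] at this
    refine ⟨this, ?_⟩
    rw [← add_sub_right_comm, ← h1]
    intro h
    exact thinCoord_ne_one (a + (i : ZMod L')) (by
      have := congrArg (· + u) h
      simpa using this)

end Summit.QuantumFields.YangMills.Theorems.FlatTubeReduction.Decimation
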